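import Summits.ValiantsHypothesis.ValiantsHypothesis.Theorems.LacunarySymmetroidMatrixDescartesKernelDefiniteJunctionBivariate

/-!
# Kernel-definite junction, part 6: the bivariate determinant — evaluations and the junction identity

Helper file for the stub `stub_kernelDefiniteJunction` of the line `junction_ceiling` (crux `MatrixDescartes`,
stmt-ValiantsHypothesis-18050).  Continues part 5 (same entrywise hypothesis `hH` for the bivariate matrix
`𝓗(x,y)`, `G = det 𝓗`, `F i j = [x^i y^j] G`):
* `eval_G` — `G(x, y) = det (∑ x^{d l − d 0} S l + x^{ã} ∑ y^{e l − e 0} T l)` and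
  `G(x, y) = ∑_{i ≤ I} ∑_{j ≤ J} F i j y^j x^i`;
* `det_junction_eq` — THE JUNCTION IDENTITY `det H_Λ = X^{m d 0} · ∑ F i j Λ^{-j} X^{i+j}` (the two-scale family
  of parts 2–4), proved pointwise via the tree's `eval_det_pencil`;
* `edgeOne_eq_det` — the bottom edge `∑ F i 0 X^i = det (∑ X^{d l − d 0} S l)`; `det_pencil_shift` —
  `det (∑ X^{u l} V l) = X^{m u 0} det (∑ X^{u l − u 0} V l)`; `card_posRoots_X_pow_mul` — distinct positive roots
  ignore a factor `X^k`.
[folklore]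
-/

-- `Summit.ValiantsHypothesis.ValiantsHypothesis.…` is the tree's mandated single-conjunct layout (Sub = Summit).
set_option linter.dupNamespace false
set_option autoImplicit false

namespace Summit.ValiantsHypothesis.ValiantsHypothesis.Theorems.LacunarySymmetroidMatrixDescartes.JunctionCeiling

open Polynomial Finset Matrix
open scoped BigOperators
open Summit.ValiantsHypothesis.ValiantsHypothesis.Theorems.SymmetroidDescartes (eval_det_pencil)

/-! ## 1. Generic pencil tools -/

/-- Shifting all exponents of a pencil by `u 0`: `det (∑ X^{u l} V l) = X^{m u 0} · det (∑ X^{u l − u 0} V l)` for a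
monotone exponent vector. [folklore] -/
theorem det_pencil_shift {m K : ℕ} (u : Fin (K + 1) → ℕ) (V : Fin (K + 1) → Matrix (Fin m) (Fin m) ℝ)
    (hu : Monotone u) :
    (∑ l, (X : ℝ[X]) ^ u l • (V l).map C).det =
      (X : ℝ[X]) ^ (m * u 0) * (∑ l, (X : ℝ[X]) ^ (u l - u 0) • (V l).map C).det := by
  apply Polynomial.funext
  intro t
  rw [eval_mul, eval_pow, eval_X, eval_det_pencil, eval_det_pencil]
  have h : (∑ l, t ^ u l • V l) = t ^ u 0 • ∑ l, t ^ (u l - u 0) • V l := by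
    rw [Finset.smul_sum]
    refine Finset.sum_congr rfl fun l _ => ?_
    rw [smul_smul, ← pow_add, Nat.add_sub_cancel' (hu (Fin.zero_le l))]
  rw [h, Matrix.det_smul, Fintype.card_fin, ← pow_mul, Nat.mul_comm (u 0) m]

/-- Distinct positive roots ignore a factor `X^k`. [folklore] -/
theorem card_posRoots_X_pow_mul (k : ℕ) (p : ℝ[X]) :
    (((X : ℝ[X]) ^ k * p).roots.toFinset.filter (fun t => 0 < t)).card =
      (p.roots.toFinset.filter (fun t => 0 < t)).card := by
  classical
  by_cases hp : p = 0
  · simp [hp]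
  congr 1
  ext t
  simp only [Finset.mem_filter, Multiset.mem_toFinset]
  rw [roots_mul (mul_ne_zero (pow_ne_zero _ X_ne_zero) hp), Multiset.mem_add, roots_X_pow]
  constructor
  · rintro ⟨h | h, ht⟩
    · have h' := Multiset.mem_of_mem_nsmul h
      rw [Multiset.mem_singleton] at h'
      rw [h'] at ht
      exact absurd ht (lt_irrefl _)
    · exact ⟨h, ht⟩
  · rintro ⟨h, ht⟩
    exact ⟨Or.inr h, ht⟩

/-! ## 2. Evaluations of the bivariate determinant -/

section Bivariate

variable {m : ℕ} (K₁ K₂ : ℕ) (d : Fin (K₁ + 1) → ℕ) (S : Fin (K₁ + 1) → Matrix (Fin m) (Fin m) ℝ)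
  (e : Fin (K₂ + 1) → ℕ) (T : Fin (K₂ + 1) → Matrix (Fin m) (Fin m) ℝ)
  (H : Matrix (Fin m) (Fin m) (Polynomial ℝ[X]))
  (hH : ∀ i k, H i k = (∑ l : Fin (K₁ + 1), C (C (S l i k)) * X ^ (d l - d 0)) +
    ∑ l : Fin K₂, C (C (T l.succ i k) * X ^ (e l.succ - e 0)) * X ^ (d (Fin.last K₁) - d 0))
  (F : ℕ → ℕ → ℝ) (hF : ∀ i j, F i j = ((det H).coeff i).coeff j)

include hH

/-- `G(x, y)` as the determinant of the real matrix `𝓗(x, y)`. [folklore] -/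
theorem eval_G_det (x y : ℝ) :
    ((det H).map (evalRingHom y)).eval x =
      (∑ l : Fin (K₁ + 1), x ^ (d l - d 0) • S l +
        ∑ l : Fin K₂, (x ^ (d (Fin.last K₁) - d 0) * y ^ (e l.succ - e 0)) • T l.succ).det := by
  have h := RingHom.map_det ((evalRingHom x).comp (mapRingHom (evalRingHom y))) H
  rw [RingHom.comp_apply, coe_mapRingHom, coe_evalRingHom] at h
  rw [h, RingHom.mapMatrix_apply]
  congr 1
  ext i k
  rw [Matrix.map_apply, hH, Matrix.add_apply, Matrix.sum_apply, Matrix.sum_apply]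
  simp only [RingHom.comp_apply, coe_mapRingHom, coe_evalRingHom, map_add, map_sum, Polynomial.map_mul,
    Polynomial.map_pow, map_C, map_X, eval_mul, eval_pow, eval_C, eval_X,
    Matrix.smul_apply, smul_eq_mul]
  congr 1
  · exact Finset.sum_congr rfl fun l _ => mul_comm _ _
  · exact Finset.sum_congr rfl fun l _ => by ring

include hF in
/-- `G(x, y)` as the double sum of its coefficients. [folklore] -/
theorem eval_G_sum (hd : Monotone d) (he : Monotone e) (x y : ℝ) :
    ((det H).map (evalRingHom y)).eval x =
      ∑ i ∈ range (m * (d (Fin.last K₁) - d 0) + 1), ∑ j ∈ range (m * (e (Fin.last K₂) - e 0) + 1),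
        F i j * y ^ j * x ^ i := by
  have hdeg := natDegree_G_le K₁ K₂ d S e T H hH hd
  rw [eval_map, eval₂_eq_sum_range' (evalRingHom y) (Nat.lt_succ_of_le hdeg)]
  refine Finset.sum_congr rfl fun i _ => ?_
  rw [coe_evalRingHom, eval_eq_sum_range' (Nat.lt_succ_of_le (natDegree_coeff_G_le K₁ K₂ d S e T H hH he i)),
    Finset.sum_mul]
  refine Finset.sum_congr rfl fun j _ => ?_
  rw [hF]

omit hH in
/-- evaluation of the determinant of the junction pencil (the kernel's `H_Λ`, Sum-indexed) at a point. [folklore] -/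
theorem eval_det_junction (Λ x : ℝ) :
    ((∑ l : Fin (K₁ + 1) ⊕ Fin K₂,
        (X : ℝ[X]) ^ (Sum.elim d (fun l : Fin K₂ => d (Fin.last K₁) + (e l.succ - e 0)) l) •
          (Sum.elim S (fun l : Fin K₂ => (Λ⁻¹) ^ (e l.succ - e 0) • T l.succ) l).map C).det).eval x =
      (∑ l : Fin (K₁ + 1), x ^ d l • S l +
        ∑ l : Fin K₂, (x ^ (d (Fin.last K₁) + (e l.succ - e 0)) * (Λ⁻¹) ^ (e l.succ - e 0)) • T l.succ).det := by
  rw [eval_det_pencil, Fintype.sum_sum_type]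
  simp only [Sum.elim_inl, Sum.elim_inr, smul_smul]

include hF in
/-- **THE JUNCTION IDENTITY**: `det H_Λ = X^{m d 0} · ∑ F i j Λ^{-j} X^{i+j}`. [folklore] -/
theorem det_junction_eq (hd : Monotone d) (he : Monotone e) (Λ : ℝ) :
    (∑ l : Fin (K₁ + 1) ⊕ Fin K₂,
        (X : ℝ[X]) ^ (Sum.elim d (fun l : Fin K₂ => d (Fin.last K₁) + (e l.succ - e 0)) l) •
          (Sum.elim S (fun l : Fin K₂ => (Λ⁻¹) ^ (e l.succ - e 0) • T l.succ) l).map C).det =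
      (X : ℝ[X]) ^ (m * d 0) *
        ∑ i ∈ range (m * (d (Fin.last K₁) - d 0) + 1), ∑ j ∈ range (m * (e (Fin.last K₂) - e 0) + 1),
          C (F i j * (Λ⁻¹) ^ j) * X ^ (i + j) := by
  apply Polynomial.funext
  intro x
  rw [eval_det_junction, eval_mul, eval_pow, eval_X]
  -- factor `x^{d 0}` out of the real matrix
  have hmat : (∑ l : Fin (K₁ + 1), x ^ d l • S l +
      ∑ l : Fin K₂, (x ^ (d (Fin.last K₁) + (e l.succ - e 0)) * (Λ⁻¹) ^ (e l.succ - e 0)) • T l.succ) =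
      x ^ d 0 • (∑ l : Fin (K₁ + 1), x ^ (d l - d 0) • S l +
        ∑ l : Fin K₂, (x ^ (d (Fin.last K₁) - d 0) * (x * Λ⁻¹) ^ (e l.succ - e 0)) • T l.succ) := by
    rw [smul_add, Finset.smul_sum, Finset.smul_sum]
    congr 1
    · refine Finset.sum_congr rfl fun l _ => ?_
      rw [smul_smul, ← pow_add, Nat.add_sub_cancel' (hd (Fin.zero_le l))]
    · refine Finset.sum_congr rfl fun l _ => ?_
      rw [smul_smul]
      congr 1
      have hx : x ^ d (Fin.last K₁) = x ^ d 0 * x ^ (d (Fin.last K₁) - d 0) := by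
        rw [← pow_add, Nat.add_sub_cancel' (hd (Fin.zero_le _))]
      rw [pow_add, hx]
      ring
  rw [hmat, Matrix.det_smul, Fintype.card_fin, ← pow_mul, ← eval_G_det K₁ K₂ d S e T H hH,
    eval_G_sum K₁ K₂ d S e T H hH F hF hd he, eval_finsetSum, mul_comm (d 0) m]
  congr 1
  refine Finset.sum_congr rfl fun i _ => ?_
  rw [eval_finsetSum]
  refine Finset.sum_congr rfl fun j _ => ?_
  simp only [eval_mul, eval_C, eval_pow, eval_X, mul_pow, pow_add]
  ring

include hF in
/-- **bottom edge** `∑ F i 0 X^i = det (∑ X^{d l − d 0} S l)` (the shifted `P`). [folklore] -/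
theorem edgeOne_eq_det (hd : Monotone d) (he : StrictMono e) :
    (∑ i ∈ range (m * (d (Fin.last K₁) - d 0) + 1), C (F i 0) * X ^ i : ℝ[X]) =
      (∑ l : Fin (K₁ + 1), (X : ℝ[X]) ^ (d l - d 0) • (S l).map C).det := by
  apply Polynomial.funext
  intro x
  rw [eval_det_pencil]
  have h := eval_G_sum K₁ K₂ d S e T H hH F hF hd he.monotone x 0
  rw [eval_G_det K₁ K₂ d S e T H hH] at h
  have hzero : (∑ l : Fin K₂, (x ^ (d (Fin.last K₁) - d 0) * (0 : ℝ) ^ (e l.succ - e 0)) • T l.succ) = 0 := by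
    refine Finset.sum_eq_zero fun l _ => ?_
    have : e l.succ - e 0 ≠ 0 := Nat.sub_ne_zero_of_lt (he (Fin.succ_pos l))
    rw [zero_pow this, mul_zero, zero_smul]
  rw [hzero, add_zero] at h
  rw [h, eval_finsetSum]
  refine Finset.sum_congr rfl fun i _ => ?_
  rw [eval_mul, eval_C, eval_pow, eval_X, Finset.sum_eq_single_of_mem 0 (by simp)]
  · simp
  · intro j _ hj
    rw [zero_pow hj, mul_zero, zero_mul]

include hF in
/-- **right edge** `∑ F I j X^j = det Q̃`. [folklore] -/
theorem edgeThree_eq_det (hd : StrictMono d) (he : Monotone e) (h0 : T 0 = S (Fin.last K₁)) :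
    (∑ j ∈ range (m * (e (Fin.last K₂) - e 0) + 1), C (F (m * (d (Fin.last K₁) - d 0)) j) * X ^ j : ℝ[X]) =
      (∑ l : Fin (K₂ + 1), (X : ℝ[X]) ^ (e l - e 0) • (T l).map C).det := by
  rw [← coeff_G_top K₁ K₂ d S e T H hH hd h0]
  conv_rhs => rw [as_sum_range_C_mul_X_pow' _
    (Nat.lt_succ_of_le (natDegree_coeff_G_le K₁ K₂ d S e T H hH he (m * (d (Fin.last K₁) - d 0))))]
  refine Finset.sum_congr rfl fun j _ => ?_
  rw [hF]

end Bivariate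

end Summit.ValiantsHypothesis.ValiantsHypothesis.Theorems.LacunarySymmetroidMatrixDescartes.JunctionCeiling
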